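import Literature.AnabelianGeometry.SemiGraphs.SectionPullback

/-!
# Twists supported away from the section are invisible to the section pull-back
# ([SemiAnbd] §2, Def. 2.2 (i) p. 23, Cor. 2.7 (i) p. 30)

Mochizuki, *Semi-graphs of anabelioids*, Publ. RIMS **42** (2006) 221–322, §2, Def. 2.2 (i) p. 23 (the
edges of the covering attached to `A` over `e` "correspond to the connected components of `T_e`"),
proof of Cor. 2.7 (i) p. 30 [cite: MochizukiSemiAnbd2006, Cor. 2.7(i) p.30].

abc-iut cell, layer L3, FACT-LIST row F-1487 (`covering_subgraphComponents_doubleCosets` AS TYPED), seat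
abc-iut-w4-d080 — brick (R3b) of the tree-free «regluing invisibility» route
(`HOME/staging/w4/w4-d080-g7/F1487-MASSBALANCE-MEMO.md` §5), over (R1) `BObjReglue`, (R2)/(R3a)
`SectionPullback` ((R4) `SectionPullbackGlobal` is the consumer).  PROOF-ONLY:

* `Hom.pullbackTwist_hom_eq` — the pulled-back twist `θ^φ_{b′}` of `Hom.pullbackTwist` IS
  `φ_{e′}^*(θ_{φ b′})` conjugated by the re-indexing `reindexIso` along `e(φ b′) = φ e(b′)`;
* `Hom.fst_comp_pullbackTwist_hom_eq` — **the support lemma**: if `θ_{φ b′}` is the identity on the part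
  `g_e⁻¹(C)` of `B_e` over a sub-object `m : C ↪ A_e` (`e = e(φ b′)`), and the section `s_{e′}` factors
  through `φ_{e′}^*(C)` (re-indexed), then `θ^φ_{b′}` is the identity on the edge cell
  `(φ^*B)_{e′} ×_{(φ^*A)_{e′}} T_{e′}` of the section pull-back — the hypothesis `hinv` of
  `Hom.sectionPullback_reglue` / `Hom.overIsoOfInvisibleReglue` at `b′`.  (Exactness of `φ_{e′}^*`: it
  preserves the pullback `B_e ×_{A_e} C`.)

In the application `C` is the union of the components of `A_e` other than the reglued one `Q*`, and the
factorisation of `s_{e′}` through `φ_{e′}^*(O_E(e′))`, `O_E(e′) ≠ Q*`, is clause (4) of `Hom.tie_localLabels`.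
No definition, no new `Prop`; nothing here takes a side on [IUTchIII] Cor. 3.12.
-/

namespace Literature.AnabelianGeometry.SemiGraphs

open CategoryTheory CategoryTheory.Limits

-- objects occur under several definitionally equal presentations (`(F ⋙ G).obj X`, cells of `φ^*B`);
-- let unification see through them.
set_option backward.isDefEq.respectTransparency false

universe v₁ u₁ u

namespace SemiGraphOfAnabelioids

namespace Hom

variable {𝒢' 𝒢 : SemiGraphOfAnabelioids.{v₁, u₁, u}} (φ : Hom 𝒢' 𝒢)

/-- **The pulled-back twist, explicitly**: `θ^φ_{b′} = R⁻¹ ≫ φ_{e′}^*(θ_{φ b′}) ≫ R` with `R` the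
re-indexing isomorphism of `(φ^*B)_{e′}` along `e(φ b′) = φ e(b′)`.
[cite: MochizukiSemiAnbd2006, Rem. 2.11.1 p.32] -/
theorem pullbackTwist_hom_eq (B : 𝒢.BObj)
    (θ : ∀ b : 𝒢.graph.Branch, B.T (𝒢.graph.edgeOf b) ≅ B.T (𝒢.graph.edgeOf b))
    (b' : 𝒢'.graph.Branch) (v' : 𝒢'.graph.Vertex) (h' : 𝒢'.graph.abuts b' = some v') :
    (φ.pullbackTwist B θ b' v' h').hom =
      (φ.reindexIso (𝒢'.graph.edgeOf b') _ _ (φ.base.edgeOf_branchMap b').symm rfl).inv.app B ≫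
        (φ.φE (𝒢'.graph.edgeOf b') (𝒢.graph.edgeOf (φ.base.branchMap b'))
            (φ.base.edgeOf_branchMap b').symm).pullback.map (θ (φ.base.branchMap b')).hom ≫
          (φ.reindexIso (𝒢'.graph.edgeOf b') _ _ (φ.base.edgeOf_branchMap b').symm rfl).hom.app B := by
  have h1 := φ.ψ_hom_comp_pullbackTwist_hom B θ b' v' h'
  have h2 : ((φ.pullbackFunctor.obj B).ψ b' v' h').hom =
      (φ.φB b' v' h').hom.app (B.S (φ.base.vertexMap v')) ≫
        (φ.φE (𝒢'.graph.edgeOf b') (𝒢.graph.edgeOf (φ.base.branchMap b'))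
            (φ.base.edgeOf_branchMap b').symm).pullback.map
          (B.ψ (φ.base.branchMap b') (φ.base.vertexMap v') (φ.base.abuts_branchMap b' v' h')).hom ≫
        (φ.reindexIso (𝒢'.graph.edgeOf b') _ _ (φ.base.edgeOf_branchMap b').symm rfl).hom.app B := rfl
  apply (cancel_epi ((φ.pullbackFunctor.obj B).ψ b' v' h').hom).mp
  refine h1.trans ?_
  rw [h2]
  simp only [Category.assoc, Iso.hom_inv_id_app_assoc, Functor.map_comp]

section Support

variable {A : 𝒢.BObj} {T : 𝒢'.BObj} (s : T ⟶ φ.pullbackFunctor.obj A) {B : 𝒢.BObj} (g : B ⟶ A)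
  (θ : ∀ b : 𝒢.graph.Branch, B.T (𝒢.graph.edgeOf b) ≅ B.T (𝒢.graph.edgeOf b))

/-- **The support lemma.**  At a branch `b′` of `𝒢′` (over `b := φ b′`, `e := e(b)`, `e′ := e(b′)`), let
`m : C → A_e` and suppose (i) `θ_b` is the identity on `B_e ×_{A_e} C` (`fst ≫ θ_b = fst`) and (ii) the
section `s_{e′} : T_{e′} → (φ^*A)_{e′}` factors through `φ_{e′}^*(m)` (re-indexed along `e(φ b′) = φ e′`).
Then the pulled-back twist `θ^φ_{b′}` is the identity on the edge cell of the section pull-back: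
`fst ≫ θ^φ_{b′} = fst`. [cite: MochizukiSemiAnbd2006, Cor. 2.7(i) p.30] -/
theorem fst_comp_pullbackTwist_hom_eq (b' : 𝒢'.graph.Branch) (v' : 𝒢'.graph.Vertex)
    (h' : 𝒢'.graph.abuts b' = some v') {C : 𝒢.E (𝒢.graph.edgeOf (φ.base.branchMap b'))}
    (m : C ⟶ A.T (𝒢.graph.edgeOf (φ.base.branchMap b')))
    (hsupp : pullback.fst (g.fT (𝒢.graph.edgeOf (φ.base.branchMap b'))) m ≫
        (θ (φ.base.branchMap b')).hom = pullback.fst (g.fT (𝒢.graph.edgeOf (φ.base.branchMap b'))) m)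
    (hsec : ∃ t : T.T (𝒢'.graph.edgeOf b') ⟶
        (φ.φE (𝒢'.graph.edgeOf b') (𝒢.graph.edgeOf (φ.base.branchMap b'))
          (φ.base.edgeOf_branchMap b').symm).pullback.obj C,
      t ≫ (φ.φE (𝒢'.graph.edgeOf b') (𝒢.graph.edgeOf (φ.base.branchMap b'))
            (φ.base.edgeOf_branchMap b').symm).pullback.map m ≫
          (φ.reindexIso (𝒢'.graph.edgeOf b') _ _ (φ.base.edgeOf_branchMap b').symm rfl).hom.app A =
        s.fT (𝒢'.graph.edgeOf b')) :
    pullback.fst (φ.spLegT g (𝒢'.graph.edgeOf b')) (s.fT (𝒢'.graph.edgeOf b')) ≫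
        (φ.pullbackTwist B θ b' v' h').hom =
      pullback.fst (φ.spLegT g (𝒢'.graph.edgeOf b')) (s.fT (𝒢'.graph.edgeOf b')) := by
  obtain ⟨t, ht⟩ := hsec
  -- notation
  let e' := 𝒢'.graph.edgeOf b'
  let b := φ.base.branchMap b'
  let f := 𝒢.graph.edgeOf b
  let G := (φ.φE e' f (φ.base.edgeOf_branchMap b').symm).pullback
  let R := φ.reindexIso e' f (φ.base.edgeMap e') (φ.base.edgeOf_branchMap b').symm rfl
  haveI : PreservesFiniteLimits G := (φ.φE e' f (φ.base.edgeOf_branchMap b').symm).property.1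
  let FST := pullback.fst (φ.spLegT g e') (s.fT e')
  let SND := pullback.snd (φ.spLegT g e') (s.fT e')
  -- naturality of the re-indexing along `g : B → A`
  have hnat : R.inv.app B ≫ G.map (g.fT f) = φ.spLegT g e' ≫ R.inv.app A := (R.inv.naturality g).symm
  have hRA : R.hom.app A ≫ R.inv.app A = 𝟙 _ := R.hom_inv_id_app A
  have hRB : R.inv.app B ≫ R.hom.app B = 𝟙 _ := R.inv_hom_id_app B
  -- the first projection, read in the `e`-presentation, lands over `C`
  have hzc : (FST ≫ R.inv.app B) ≫ G.map (g.fT f) = (SND ≫ t) ≫ G.map m :=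
    calc (FST ≫ R.inv.app B) ≫ G.map (g.fT f)
        = FST ≫ (R.inv.app B ≫ G.map (g.fT f)) := Category.assoc _ _ _
      _ = FST ≫ (φ.spLegT g e' ≫ R.inv.app A) := congrArg _ hnat
      _ = (FST ≫ φ.spLegT g e') ≫ R.inv.app A := (Category.assoc _ _ _).symm
      _ = (SND ≫ s.fT e') ≫ R.inv.app A := congrArg (· ≫ _) pullback.condition
      _ = (SND ≫ (t ≫ G.map m ≫ R.hom.app A)) ≫ R.inv.app A := by rw [ht]
      _ = (SND ≫ t) ≫ G.map m ≫ (R.hom.app A ≫ R.inv.app A) := by simp only [Category.assoc]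
      _ = (SND ≫ t) ≫ G.map m := by
          rw [hRA]
          exact congrArg _ (Category.comp_id _)
  -- hence it factors through `φ_{e′}^*(B_e ×_{A_e} C)` (exactness of `φ_{e′}^*`)
  let u : pullback (φ.spLegT g e') (s.fT e') ⟶ pullback (G.map (g.fT f)) (G.map m) :=
    pullback.lift (FST ≫ R.inv.app B) (SND ≫ t) hzc
  have hzu : FST ≫ R.inv.app B =
      u ≫ (PreservesPullback.iso G (g.fT f) m).inv ≫ G.map (pullback.fst (g.fT f) m) := by
    rw [PreservesPullback.iso_inv_fst, pullback.lift_fst]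
  -- on which the twist acts trivially
  have key : (FST ≫ R.inv.app B) ≫ G.map (θ b).hom = FST ≫ R.inv.app B :=
    calc (FST ≫ R.inv.app B) ≫ G.map (θ b).hom
        = (u ≫ (PreservesPullback.iso G (g.fT f) m).inv ≫ G.map (pullback.fst (g.fT f) m)) ≫
            G.map (θ b).hom := congrArg (· ≫ _) hzu
      _ = u ≫ (PreservesPullback.iso G (g.fT f) m).inv ≫
            G.map (pullback.fst (g.fT f) m ≫ (θ b).hom) := by
          simp only [Category.assoc, Functor.map_comp]
      _ = u ≫ (PreservesPullback.iso G (g.fT f) m).inv ≫ G.map (pullback.fst (g.fT f) m) := by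
          rw [hsupp]
      _ = FST ≫ R.inv.app B := hzu.symm
  -- conclude
  rw [pullbackTwist_hom_eq]
  calc FST ≫ R.inv.app B ≫ G.map (θ b).hom ≫ R.hom.app B
      = ((FST ≫ R.inv.app B) ≫ G.map (θ b).hom) ≫ R.hom.app B := by simp only [Category.assoc]
    _ = (FST ≫ R.inv.app B) ≫ R.hom.app B := congrArg (· ≫ _) key
    _ = FST ≫ (R.inv.app B ≫ R.hom.app B) := Category.assoc _ _ _
    _ = FST := by
        rw [hRB]
        exact Category.comp_id _

end Support

end Hom

end SemiGraphOfAnabelioids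

end Literature.AnabelianGeometry.SemiGraphs
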